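import Summits.BirchSwinnertonDyer.BirchSwinnertonDyer.Theorems.KolyvaginDepthDoorDepthTableKuriharaGoodPrime
import Summits.BirchSwinnertonDyer.BirchSwinnertonDyer.Theorems.KolyvaginDepthDoorDepthTableKuriharaDecisivePair
import Summits.BirchSwinnertonDyer.BirchSwinnertonDyer.Theorems.Rank2ObservatoryRank2Table
import HarnessLib

/-!
# Route `KolyvaginDepthDoor`, crux `KolyvaginDepthSupplyKN` (stmt-BirchSwinnertonDyer-22820) —
# DEPTH TABLE v26 «THE RECORD PINS THE RANK»: a depth-two unit Kurihara record together with its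
# companion localisation certificate is a COMPLETE rank-two certificate modulo print —
# `2 ≤ rank_ℤ E(ℚ)` from the matrix (kernel, unconditional), `rank_ℤ E(ℚ) ≤ 2 ∧ Ш(E/ℚ)[p] = 0` from the unit

Helper file of the lead prover of line `levelone` (kdd-p1 g30; `--supports stmt-BirchSwinnertonDyer-22820
--as helper`); it closes nothing and BSD is NOT proved by it.

## What is new

Every E-side row of the depth table since v22 carries TWO kernel objects for a rank-two curve `E` at its
recorded depth-two level `n = ℓ₁ℓ₂`: the READING «unit `δ̃_n(E)` ⟹ `Ш(E/ℚ)[p] = 0`» (Kim, Thm. 1.11; its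
hypothesis `ν(n) ≤ rank` was fed by `2 ≤ rank` from a 2-DESCENT module `Rank2ObservatoryKernelCerts*`), and
the AGREEMENT certificate `localizationInvertible_<p>_<n>`: the localisation matrix of two rational points
`P₁, P₂` at `(ℓ₁, ℓ₂)` is invertible mod `p` — `P₂`, `P₁`, `P₁ + t•P₂` (`1 ≤ t < p`) each `p`-indivisible in
`E(ℚ_{ℓ₁})` or `E(ℚ_{ℓ₂})` (hypotheses `h01`, `h10`, `h1t` of v22's
`sha_inf_torsionBy_eq_bot_iff_kuriharaClaim_pair`) —, so far DECORATIVE (the print-predicted companion of the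
unit). v26 makes the second object LOAD-BEARING:

* §1 `two_le_mordellWeilRank_of_localWitness` — UNCONDITIONAL, any elliptic `W/ℚ`, any prime `p` with `E[p]`
  irreducible: the three local witnesses give `2 ≤ rank_ℤ E(ℚ)`. (Every non-trivial `𝔽_p`-combination of
  `P₁, P₂` is locally `p`-indivisible (v22 `localWitness_of_representatives`), hence not in `pE(ℚ)`; with
  `E(ℚ)[p] = 0` (Mazur: irreducible ⟹ no rational `p`-torsion) a `ℤ`-relation `sP₁ + tP₂ = 0` descends
  `(s, t) ↦ (s/p, t/p)` to `(0, 0)`; Mordell–Weil, proved in the tree, turns `ℤ`-independence into rank.)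
* §2 `mordellWeilRank_le_of_natCard_selmerGroup_le_pow` — UNCONDITIONAL: `#Sel_p(E/ℚ) ≤ p^ν ⟹ rank ≤ ν` (the
  exact descent count `#Sel_p = p^{rank}·#E(ℚ)[p]·#Ш[p]`, AEC X.4.2).
* §3 `rank_eq_two_and_sha_eq_bot_of_kuriharaClaim_of_localWitness` — THE SELF-CERTIFYING ROW at ANY good
  prime `p ≥ 5` (Kim's binders (iii) `E(ℚ_p)[p] = 0`, (iv) `p ∤ ∏ c_v` verbatim): unit `δ̃_{ℓ₁ℓ₂}(E)` (the
  CLAIM of a tree record) + the three local witnesses ⟹ `rank_ℤ E(ℚ) = 2` EXACTLY ∧ `Ш(E/ℚ)[p] = 0`. No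
  `2 ≤ rank` hypothesis, no 2-descent: the upper bound is Kim's `#Sel_p ≤ p²`, the lower bound is §1.
* §4 `kuriharaClaim_pair_iff_rank_eq_two_and_sha_eq_bot` — the TWO-WAY form on the ordinary non-anomalous
  Kodaira–Néron cell with the rank INSIDE the equivalence: «unit `δ̃_{ℓ₁ℓ₂}(E)` for every admissible datum ⟺
  `rank_ℤ E(ℚ) = 2 ∧ Ш(E/ℚ)[p] = 0`» given the three local witnesses (`⟸` Sakamoto L4.4/L4.6 as in v22).
* Row shapes for a literal integral model (supersingular / any good prime) are in the companion file
  `KolyvaginDepthDoorDepthTableKuriharaRankPinInt`; the per-record files feed their existing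
  `localizationInvertible_<p>_<n>` theorem in verbatim.

So a depth-two unit record whose companion matrix is certified reads, modulo the named print facts, as an
EXACT-RANK certificate — an instrument for the rank upper bound independent of 2-descent (it also applies
where `Ш(E)[2] ≠ 0` spoils 2-descent), and the v25 rows that were «Cert-only» for want of a built
`Rank2ObservatoryKernelCerts*` module need no such module.

HONEST FRAMING. Per curve; CONDITIONAL on the named facts displayed as hypotheses (`hKimG`, `hnf`, `hMaz`,
and `hSakR` for `⟸`) and on the record's CLAIM (nobody proves `kuriharaNumber ≠ 0` in the kernel; the record
pins modular-symbol data and the kernel rechecks the arithmetic to `δ̃`); §1–§2 are unconditional. Nothing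
class-wide: the open stub (S♭) of the line is untouched (X1-type, `SelmerRankBarrierNarrow`); BSD is NOT
proved by any of this.

References: [Kim2022StructureSelmer] C.-H. Kim, Amer. J. Math. 148 (2026) Thm. 1.11 with hypotheses
(i)–(iv) and the «in this case» clause (PDF p. 8); [Sakamoto2022pSelmer] Lemma 4.4, Remark 4.5, Lemma 4.6 (1);
[Mazur1977] Ch. III §5 p. 157; [SilvermanAEC2009] III.2.3, VII.3.1, VIII.6.7, X.4.2.
-/

set_option linter.dupNamespace false

noncomputable section

open scoped Classical NumberField

namespace Summit.BirchSwinnertonDyer.BirchSwinnertonDyer.Theorems.KolyvaginDepthDoor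

open Literature.NumberTheory.EllipticCurves Literature.NumberTheory.EllipticCurves.ModularForms
  WeierstrassCurve NumberField IsDedekindDomain
open Summit.BirchSwinnertonDyer.BirchSwinnertonDyer.Theorems
open Summit.BirchSwinnertonDyer.BirchSwinnertonDyer.Rank2Observatory

/-! ## §1 The rank lower bound from the localisation matrix (unconditional) -/

/-- **`2 ≤ rank_ℤ E(ℚ)` from three local witnesses** (UNCONDITIONAL). `W/ℚ` elliptic, `p` a prime with
`E[p]` irreducible, `P₁, P₂ ∈ E(ℚ)`, primes `ℓ₁, ℓ₂`: if `P₂`, `P₁` and every `P₁ + t•P₂` (`1 ≤ t < p`) is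
NOT divisible by `p` in `E(ℚ_{ℓ₁})` or in `E(ℚ_{ℓ₂})` — the rows' «localisation matrix at `(ℓ₁, ℓ₂)`
invertible mod `p`» — then `P₁, P₂` are `ℤ`-linearly independent, so `2 ≤ rank_ℤ E(ℚ)` (Mordell–Weil, proved in
the tree). Proof: every `(a, b) ≢ (0, 0)` combination is locally `p`-indivisible
(`localWitness_of_representatives`), hence `sP₁ + tP₂ = 0` forces `p ∣ s`, `p ∣ t`; then
`p•((s/p)P₁ + (t/p)P₂) = 0` and `E(ℚ)[p] = 0` (irreducibility, Mazur p. 157) give a smaller relation —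
descent on `|s| + |t|`. [cite: SilvermanAEC2009, Thm. VIII.6.7] [cite: Mazur1977, Ch. III §5, p. 157] -/
theorem two_le_mordellWeilRank_of_localWitness (W : WeierstrassCurve ℚ) [W.IsElliptic]
    (p : ℕ) [hp : Fact p.Prime] (hirr : W.HasIrreducibleModPGaloisRep p)
    (ℓ₁ ℓ₂ : ℕ) [Fact ℓ₁.Prime] [Fact ℓ₂.Prime] (P₁ P₂ : W.toAffine.Point)
    (h01 : (∀ Q : (W.baseChange ℚ_[ℓ₁]).toAffine.Point,
        p • Q ≠ WeierstrassCurve.Affine.Point.map (W' := W.toAffine) (S := ℚ) (Algebra.ofId ℚ ℚ_[ℓ₁]) P₂) ∨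
      (∀ Q : (W.baseChange ℚ_[ℓ₂]).toAffine.Point,
        p • Q ≠ WeierstrassCurve.Affine.Point.map (W' := W.toAffine) (S := ℚ) (Algebra.ofId ℚ ℚ_[ℓ₂]) P₂))
    (h10 : (∀ Q : (W.baseChange ℚ_[ℓ₁]).toAffine.Point,
        p • Q ≠ WeierstrassCurve.Affine.Point.map (W' := W.toAffine) (S := ℚ) (Algebra.ofId ℚ ℚ_[ℓ₁]) P₁) ∨
      (∀ Q : (W.baseChange ℚ_[ℓ₂]).toAffine.Point,
        p • Q ≠ WeierstrassCurve.Affine.Point.map (W' := W.toAffine) (S := ℚ) (Algebra.ofId ℚ ℚ_[ℓ₂]) P₁))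
    (h1t : ∀ t, 1 ≤ t → t < p →
      (∀ Q : (W.baseChange ℚ_[ℓ₁]).toAffine.Point,
        p • Q ≠ 1 • WeierstrassCurve.Affine.Point.map (W' := W.toAffine) (S := ℚ) (Algebra.ofId ℚ ℚ_[ℓ₁]) P₁ +
          t • WeierstrassCurve.Affine.Point.map (W' := W.toAffine) (S := ℚ) (Algebra.ofId ℚ ℚ_[ℓ₁]) P₂) ∨
      (∀ Q : (W.baseChange ℚ_[ℓ₂]).toAffine.Point,
        p • Q ≠ 1 • WeierstrassCurve.Affine.Point.map (W' := W.toAffine) (S := ℚ) (Algebra.ofId ℚ ℚ_[ℓ₂]) P₁ +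
          t • WeierstrassCurve.Affine.Point.map (W' := W.toAffine) (S := ℚ) (Algebra.ofId ℚ ℚ_[ℓ₂]) P₂)) :
    2 ≤ W.mordellWeilRank := by
  have hpP : p.Prime := hp.out
  have hp0 : (p : ℤ) ≠ 0 := by exact_mod_cast hpP.ne_zero
  -- the two localisation homomorphisms, typed over `E(ℚ)` itself
  let φ₁ : W.toAffine.Point →+ (W.baseChange ℚ_[ℓ₁]).toAffine.Point :=
    WeierstrassCurve.Affine.Point.map (W' := W.toAffine) (S := ℚ) (Algebra.ofId ℚ ℚ_[ℓ₁])
  let φ₂ : W.toAffine.Point →+ (W.baseChange ℚ_[ℓ₂]).toAffine.Point :=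
    WeierstrassCurve.Affine.Point.map (W' := W.toAffine) (S := ℚ) (Algebra.ofId ℚ ℚ_[ℓ₂])
  have hall : ∀ a b : ℕ, ¬ (p ∣ a ∧ p ∣ b) →
      (∀ Q : (W.baseChange ℚ_[ℓ₁]).toAffine.Point, p • Q ≠ a • φ₁ P₁ + b • φ₁ P₂) ∨
        (∀ Q : (W.baseChange ℚ_[ℓ₂]).toAffine.Point, p • Q ≠ a • φ₂ P₁ + b • φ₂ P₂) :=
    localWitness_of_representatives p (φ₁ P₁) (φ₁ P₂) (φ₂ P₁) (φ₂ P₂) h01 h10 h1t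
  -- Step A: a relation `s•P₁ + t•P₂ = 0` has both coefficients divisible by `p`
  have stepA : ∀ s t : ℤ, s • P₁ + t • P₂ = 0 → (p : ℤ) ∣ s ∧ (p : ℤ) ∣ t := by
    intro s t hst
    by_contra hnd
    obtain ⟨a, ha⟩ : ∃ a : ℕ, (a : ℤ) = s % p := ⟨(s % p).toNat, Int.toNat_of_nonneg (Int.emod_nonneg _ hp0)⟩
    obtain ⟨b, hb⟩ : ∃ b : ℕ, (b : ℤ) = t % p := ⟨(t % p).toNat, Int.toNat_of_nonneg (Int.emod_nonneg _ hp0)⟩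
    have hs : s % (p : ℤ) + p * (s / p) = s := by rw [Int.emod_def]; ring
    have ht : t % (p : ℤ) + p * (t / p) = t := by rw [Int.emod_def]; ring
    have hab : ¬ (p ∣ a ∧ p ∣ b) := by
      rintro ⟨hpa, hpb⟩
      apply hnd
      have hpa' : (p : ℤ) ∣ s % p := by rw [← ha]; exact_mod_cast hpa
      have hpb' : (p : ℤ) ∣ t % p := by rw [← hb]; exact_mod_cast hpb
      have hds := dvd_add hpa' (dvd_mul_right (p : ℤ) (s / p))
      have hdt := dvd_add hpb' (dvd_mul_right (p : ℤ) (t / p))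
      rw [hs] at hds
      rw [ht] at hdt
      exact ⟨hds, hdt⟩
    -- the `(a, b)` combination is `p`-divisible in `E(ℚ)` already
    set R : W.toAffine.Point := (s / p) • P₁ + (t / p) • P₂ with hR
    have e : (a : ℤ) • P₁ + (b : ℤ) • P₂ = (p : ℤ) • (-R) := by
      have ha' : (a : ℤ) = s - p * (s / p) := by rw [ha, Int.emod_def]
      have hb' : (b : ℤ) = t - p * (t / p) := by rw [hb, Int.emod_def]
      have e1 : (s - p * (s / p)) • P₁ + (t - p * (t / p)) • P₂ =
          (s • P₁ + t • P₂) - (p : ℤ) • R := by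
        rw [hR]; module
      rw [ha', hb', e1, hst, zero_sub]
      exact (smul_neg (p : ℤ) R).symm
    have eN : a • P₁ + b • P₂ = p • (-R) := by
      rw [← natCast_zsmul, ← natCast_zsmul, ← natCast_zsmul]; exact e
    rcases hall a b hab with h | h
    · refine h (φ₁ (-R)) ?_
      rw [← map_nsmul, ← eN, map_add, map_nsmul, map_nsmul]
    · refine h (φ₂ (-R)) ?_
      rw [← map_nsmul, ← eN, map_add, map_nsmul, map_nsmul]
  -- Step B: descent on `|s| + |t|` using `E(ℚ)[p] = 0`
  have stepB : ∀ m : ℕ, ∀ s t : ℤ, s.natAbs + t.natAbs = m → s • P₁ + t • P₂ = 0 → s = 0 ∧ t = 0 := by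
    intro m
    induction m using Nat.strong_induction_on with
    | _ m ih =>
      intro s t hm hst
      by_cases h0 : s = 0 ∧ t = 0
      · exact h0
      obtain ⟨⟨s₁, rfl⟩, ⟨t₁, rfl⟩⟩ := stepA s t hst
      have hR : (p : ℤ) • (s₁ • P₁ + t₁ • P₂) = 0 := by
        calc (p : ℤ) • (s₁ • P₁ + t₁ • P₂) = (p * s₁ : ℤ) • P₁ + (p * t₁ : ℤ) • P₂ := by module
          _ = 0 := hst
      have hR0 : s₁ • P₁ + t₁ • P₂ = 0 := by
        by_contra hne
        have hpR : p • (s₁ • P₁ + t₁ • P₂) = 0 := by rw [← natCast_zsmul]; exact hR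
        exact not_exists_addOrderOf_eq_of_hasIrreducibleModPGaloisRep W hirr ⟨_, addOrderOf_eq_prime hpR hne⟩
      have hne1 : ¬ (s₁ = 0 ∧ t₁ = 0) := by
        rintro ⟨rfl, rfl⟩; exact h0 ⟨by simp, by simp⟩
      have hlt : s₁.natAbs + t₁.natAbs < m := by
        rw [← hm, Int.natAbs_mul, Int.natAbs_mul, Int.natAbs_natCast]
        have h2 : 2 ≤ p := hpP.two_le
        have hpos : 0 < s₁.natAbs + t₁.natAbs := by
          rcases not_and_or.mp hne1 with h | h
          · exact Nat.add_pos_left (Int.natAbs_pos.mpr h) _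
          · exact Nat.add_pos_right _ (Int.natAbs_pos.mpr h)
        nlinarith
      obtain ⟨rfl, rfl⟩ := ih _ hlt s₁ t₁ rfl hR0
      exact ⟨by simp, by simp⟩
  have hind : LinearIndependent ℤ ![P₁, P₂] :=
    LinearIndependent.pair_iff.mpr fun s t h ↦ stepB _ s t rfl h
  exact Rank2Observatory.two_le_mordellWeilRank_of_linearIndependent W hind

/-! ## §2 The rank upper bound from a `p`-Selmer bound (unconditional) -/

/-- **`#Sel_p(E/ℚ) ≤ p^ν ⟹ rank_ℤ E(ℚ) ≤ ν`** (any elliptic `W/ℚ`, `p` prime): the exact descent count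
`#Sel_p = p^{rank} · #E(ℚ)[p] · #Ш[p]` (`natCard_selmerGroup_eq`, AEC X.4.2) with `Sel_p` finite and non-empty
gives `p^{rank} ≤ #Sel_p`. UNCONDITIONAL. [cite: SilvermanAEC2009, Thm. X.4.2] -/
theorem mordellWeilRank_le_of_natCard_selmerGroup_le_pow (W : WeierstrassCurve ℚ) [W.IsElliptic]
    (p : ℕ) [hp : Fact p.Prime] {ν : ℕ} (h : Nat.card (W.selmerGroup p) ≤ p ^ ν) :
    W.mordellWeilRank ≤ ν := by
  have hp0 : (p : ℕ) ≠ 0 := hp.out.ne_zero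
  have hcount := W.natCard_selmerGroup_eq hp0
  haveI : Finite (W.selmerGroup p) := W.finite_selmerGroup_holds (Int.natCast_ne_zero.mpr hp0)
  have hpos : 0 < Nat.card (W.selmerGroup p) := Nat.card_pos
  -- pure arithmetic: `S = p^r·A·B`, `0 < S` ⟹ `p^r ≤ S`
  have key : ∀ {S r A B : ℕ}, S = p ^ r * A * B → 0 < S → p ^ r ≤ S := by
    intro S r A B hS hpos'
    subst hS
    have hA : 0 < A := Nat.pos_of_ne_zero (by rintro rfl; simp at hpos')
    have hB : 0 < B := Nat.pos_of_ne_zero (by rintro rfl; simp at hpos')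
    calc p ^ r = p ^ r * 1 * 1 := by ring
      _ ≤ p ^ r * A * B := by gcongr <;> omega
  have hle : p ^ W.mordellWeilRank ≤ p ^ ν := (key hcount hpos).trans h
  exact (Nat.pow_le_pow_iff_right hp.out.one_lt).mp hle

/-! ## §3 The self-certifying row at ANY good prime: rank `= 2` AND `Ш[p] = 0` from the unit and the matrix -/

/-- **THE RECORD PINS THE RANK (one way, any good `p ≥ 5`).** `W` globally minimal elliptic; `p ≥ 5` good with
`ρ̄_{E,p}` onto; Kim's binders (iii) `E(ℚ_p)[p] = 0` and (iv) `p ∤ ∏_v c_v` verbatim; `n = ℓ₁ℓ₂` a cyclic Kolyvagin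
level (`ℓ₁ ≠ ℓ₂`); `P₁, P₂ ∈ E(ℚ)` with the three local witnesses at `(ℓ₁, ℓ₂)`; and the CLAIM of a unit mod-`p`
Kurihara number at `n` (shape of `KuriharaCertificates.Record.Claim`). THEN `rank_ℤ E(ℚ) = 2` EXACTLY and
`Ш(E/ℚ)[p] = 0`: `#Sel_p(E) ≤ p²` by Kim's Theorem 1.11 (v25 §1: datum by modularity + Mazur + Néron scaling,
period transfer by Mazur), so `rank ≤ 2` (§2); `2 ≤ rank` by §1 (`E[p]` irreducible since `ρ̄` is onto); and the
descent count kills `Ш[p]`. NO `2 ≤ rank` hypothesis, no 2-descent. CONDITIONAL on `hKimG`, `hnf`, `hMaz` and the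
claim; per `(W, p, n)`; BSD is not proved by it. [cite: Kim2022StructureSelmer, Thm. 1.11 with (iii), (iv) (PDF p. 8)]
[cite: Mazur1978, Cor. 4.1] [cite: SilvermanAEC2009, Thm. VIII.6.7, Thm. X.4.2] -/
theorem rank_eq_two_and_sha_eq_bot_of_kuriharaClaim_of_localWitness
    (hKimG : Literature.NumberTheory.EllipticCurves.Kim2022_card_selmerGroup_le_pow_of_kuriharaNumber_ne_zero_of_hasGoodReduction)
    (hnf : exists_isNewformOf) (hMaz : mazur_not_dvd_maninConstant_of_odd)
    (W : WeierstrassCurve ℚ) [W.IsElliptic] [W.IsGloballyMinimal] (p : ℕ) [hp : Fact p.Prime] (h5 : 5 ≤ p)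
    (hgood : W.HasGoodReductionAtPrime p) (hsur : W.HasSurjectiveModNGaloisRep p)
    (ht0 : ∀ P : (W.baseChange ℚ_[p]).toAffine.Point, (p : ℤ) • P = 0 → P = 0)
    (htam : ¬ p ∣ W.tamagawaProduct)
    [iNZ : NeZero (W.conductorNorm ℤ)]
    (ℓ₁ ℓ₂ n : ℕ) [hℓ₁ : Fact ℓ₁.Prime] [hℓ₂ : Fact ℓ₂.Prime] (hne : ℓ₁ ≠ ℓ₂) (hnl : ℓ₁ * ℓ₂ = n)
    [NeZero n] (hn : IsCyclicKolyvaginLevel W p n)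
    (P₁ P₂ : W.toAffine.Point)
    (h01 : (∀ Q : (W.baseChange ℚ_[ℓ₁]).toAffine.Point,
        p • Q ≠ WeierstrassCurve.Affine.Point.map (W' := W.toAffine) (S := ℚ) (Algebra.ofId ℚ ℚ_[ℓ₁]) P₂) ∨
      (∀ Q : (W.baseChange ℚ_[ℓ₂]).toAffine.Point,
        p • Q ≠ WeierstrassCurve.Affine.Point.map (W' := W.toAffine) (S := ℚ) (Algebra.ofId ℚ ℚ_[ℓ₂]) P₂))
    (h10 : (∀ Q : (W.baseChange ℚ_[ℓ₁]).toAffine.Point,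
        p • Q ≠ WeierstrassCurve.Affine.Point.map (W' := W.toAffine) (S := ℚ) (Algebra.ofId ℚ ℚ_[ℓ₁]) P₁) ∨
      (∀ Q : (W.baseChange ℚ_[ℓ₂]).toAffine.Point,
        p • Q ≠ WeierstrassCurve.Affine.Point.map (W' := W.toAffine) (S := ℚ) (Algebra.ofId ℚ ℚ_[ℓ₂]) P₁))
    (h1t : ∀ t, 1 ≤ t → t < p →
      (∀ Q : (W.baseChange ℚ_[ℓ₁]).toAffine.Point,
        p • Q ≠ 1 • WeierstrassCurve.Affine.Point.map (W' := W.toAffine) (S := ℚ) (Algebra.ofId ℚ ℚ_[ℓ₁]) P₁ +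
          t • WeierstrassCurve.Affine.Point.map (W' := W.toAffine) (S := ℚ) (Algebra.ofId ℚ ℚ_[ℓ₁]) P₂) ∨
      (∀ Q : (W.baseChange ℚ_[ℓ₂]).toAffine.Point,
        p • Q ≠ 1 • WeierstrassCurve.Affine.Point.map (W' := W.toAffine) (S := ℚ) (Algebra.ofId ℚ ℚ_[ℓ₂]) P₁ +
          t • WeierstrassCurve.Affine.Point.map (W' := W.toAffine) (S := ℚ) (Algebra.ofId ℚ ℚ_[ℓ₂]) P₂))
    (hδ : ∀ (D : ModularParametrizationData W (W.conductorNorm ℤ)), ¬ (p : ℤ) ∣ D.maninConstant →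
      (∃ u : ℚ, ‖(u : ℚ_[p])‖ = 1 ∧ W.realPeriodRat = u * plusPeriod D.f) →
      ∃ ψ : (ℓ : ℕ) → (ZMod ℓ)ˣ →* Multiplicative (ZMod p),
        (∀ ℓ ∈ n.primeFactors, Function.Surjective (ψ ℓ)) ∧ kuriharaNumber D.f p n ψ ≠ 0) :
    W.mordellWeilRank = 2 ∧ (W.sha ⊓ AddSubgroup.torsionBy W.galH1 (p : ℤ) : AddSubgroup W.galH1) = ⊥ := by
  have hcard : n.primeFactors.card = 2 := by
    rw [← hnl, Nat.primeFactors_mul hℓ₁.out.ne_zero hℓ₂.out.ne_zero, hℓ₁.out.primeFactors, hℓ₂.out.primeFactors]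
    exact Finset.card_pair hne
  have hirr : W.HasIrreducibleModPGaloisRep p := hasIrreducibleModPGaloisRep_of_hasSurjectiveModNGaloisRep W p hsur
  have hle : Nat.card (W.selmerGroup p) ≤ p ^ 2 := by
    rw [← hcard]
    exact natCard_selmerGroup_le_pow_of_kuriharaClaim_of_hasGoodReduction hKimG hnf hMaz W p h5 hgood hsur ht0
      htam n hn hδ
  have hup : W.mordellWeilRank ≤ 2 := mordellWeilRank_le_of_natCard_selmerGroup_le_pow W p hle
  have hlow : 2 ≤ W.mordellWeilRank := two_le_mordellWeilRank_of_localWitness W p hirr ℓ₁ ℓ₂ P₁ P₂ h01 h10 h1t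
  have hrank : W.mordellWeilRank = 2 := le_antisymm hup hlow
  exact ⟨hrank, sha_inf_torsionBy_eq_bot_of_natCard_selmerGroup_le W p (by rw [hrank]; exact hle)⟩

/-! ## §4 The two-way form on the ordinary non-anomalous Kodaira–Néron cell, rank INSIDE the equivalence -/

/-- **THE RECORD AT THE PRESCRIBED PAIR DECIDES «rank = 2 ∧ Ш[p] = 0» BOTH WAYS.** `W` globally minimal; `p ≥ 5`
good ordinary, `ρ̄_{E,p}` onto, `a_p ≢ 1 (mod p)`, `p ∤ ord_v(Δ_min)` at multiplicative `v`; `n = ℓ₁ℓ₂` a cyclic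
Kolyvagin level; `P₁, P₂ ∈ E(ℚ)` with the three local witnesses at `(ℓ₁, ℓ₂)`. THEN «unit mod-`p` Kurihara number
at `n` for every admissible datum» ⟺ «`rank_ℤ E(ℚ) = 2 ∧ Ш(E/ℚ)[p] = 0`». `⟹` is §3 ((iii) from `a_p ≢ 1`,
(iv) from Kodaira–Néron); `⟸`: `#Sel_p(E) = p^{rank} = p²` and Sakamoto L4.4/L4.6 (1) at the pair (v22
`kuriharaClaim_pair_of_natCard_selmerGroup_le_sq`). v22 stated this with `rank = 2` as a HYPOTHESIS (kernel
2-descent); here the rank is part of what the record decides. CONDITIONAL on `hKimG`, `hnf`, `hMaz`, `hSakR`; per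
curve; BSD is not proved by it. [cite: Kim2022StructureSelmer, Thm. 1.11 (PDF p. 8)]
[cite: Sakamoto2022pSelmer, Lemma 4.4, Remark 4.5, Lemma 4.6 (1) (p. 14)] [cite: SilvermanAEC2009, Thm. X.4.2] -/
theorem kuriharaClaim_pair_iff_rank_eq_two_and_sha_eq_bot
    (hKimG : Literature.NumberTheory.EllipticCurves.Kim2022_card_selmerGroup_le_pow_of_kuriharaNumber_ne_zero_of_hasGoodReduction)
    (hnf : exists_isNewformOf) (hMaz : mazur_not_dvd_maninConstant_of_odd)
    (hSakR : Literature.NumberTheory.EllipticCurves.Sakamoto2022_kuriharaNumber_ne_zero_of_localizationInjective)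
    (W : WeierstrassCurve ℚ) [W.IsElliptic] [W.IsGloballyMinimal] (p : ℕ) [hp : Fact p.Prime] (h5 : 5 ≤ p)
    (hgood : W.HasGoodReductionAtPrime p) (hord : ¬ (p : ℤ) ∣ W.frobeniusTrace p)
    (hsur : W.HasSurjectiveModNGaloisRep p) (hna : ¬ (p : ℤ) ∣ W.frobeniusTrace p - 1)
    (hKN : ∀ v : HeightOneSpectrum (𝓞 ℚ), W.HasMultiplicativeReductionAt v → ¬ p ∣ W.ordMinimalDiscriminant v)
    [iNZ : NeZero (W.conductorNorm ℤ)]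
    (ℓ₁ ℓ₂ n : ℕ) [hℓ₁ : Fact ℓ₁.Prime] [hℓ₂ : Fact ℓ₂.Prime] (hne : ℓ₁ ≠ ℓ₂) (hnl : ℓ₁ * ℓ₂ = n)
    [NeZero n] (hn : IsCyclicKolyvaginLevel W p n)
    (P₁ P₂ : W.toAffine.Point)
    (h01 : (∀ Q : (W.baseChange ℚ_[ℓ₁]).toAffine.Point,
        p • Q ≠ WeierstrassCurve.Affine.Point.map (W' := W.toAffine) (S := ℚ) (Algebra.ofId ℚ ℚ_[ℓ₁]) P₂) ∨
      (∀ Q : (W.baseChange ℚ_[ℓ₂]).toAffine.Point,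
        p • Q ≠ WeierstrassCurve.Affine.Point.map (W' := W.toAffine) (S := ℚ) (Algebra.ofId ℚ ℚ_[ℓ₂]) P₂))
    (h10 : (∀ Q : (W.baseChange ℚ_[ℓ₁]).toAffine.Point,
        p • Q ≠ WeierstrassCurve.Affine.Point.map (W' := W.toAffine) (S := ℚ) (Algebra.ofId ℚ ℚ_[ℓ₁]) P₁) ∨
      (∀ Q : (W.baseChange ℚ_[ℓ₂]).toAffine.Point,
        p • Q ≠ WeierstrassCurve.Affine.Point.map (W' := W.toAffine) (S := ℚ) (Algebra.ofId ℚ ℚ_[ℓ₂]) P₁))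
    (h1t : ∀ t, 1 ≤ t → t < p →
      (∀ Q : (W.baseChange ℚ_[ℓ₁]).toAffine.Point,
        p • Q ≠ 1 • WeierstrassCurve.Affine.Point.map (W' := W.toAffine) (S := ℚ) (Algebra.ofId ℚ ℚ_[ℓ₁]) P₁ +
          t • WeierstrassCurve.Affine.Point.map (W' := W.toAffine) (S := ℚ) (Algebra.ofId ℚ ℚ_[ℓ₁]) P₂) ∨
      (∀ Q : (W.baseChange ℚ_[ℓ₂]).toAffine.Point,
        p • Q ≠ 1 • WeierstrassCurve.Affine.Point.map (W' := W.toAffine) (S := ℚ) (Algebra.ofId ℚ ℚ_[ℓ₂]) P₁ +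
          t • WeierstrassCurve.Affine.Point.map (W' := W.toAffine) (S := ℚ) (Algebra.ofId ℚ ℚ_[ℓ₂]) P₂)) :
    (∀ (D : ModularParametrizationData W (W.conductorNorm ℤ)), ¬ (p : ℤ) ∣ D.maninConstant →
        (∃ u : ℚ, ‖(u : ℚ_[p])‖ = 1 ∧ W.realPeriodRat = u * plusPeriod D.f) →
        ∃ ψ : (q : ℕ) → (ZMod q)ˣ →* Multiplicative (ZMod p),
          (∀ q ∈ n.primeFactors, Function.Surjective (ψ q)) ∧ kuriharaNumber D.f p n ψ ≠ 0) ↔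
      (W.mordellWeilRank = 2 ∧ (W.sha ⊓ AddSubgroup.torsionBy W.galH1 (p : ℤ) : AddSubgroup W.galH1) = ⊥) := by
  constructor
  · intro hδ
    exact rank_eq_two_and_sha_eq_bot_of_kuriharaClaim_of_localWitness hKimG hnf hMaz W p h5 hgood hsur
      (localTorsionTrivial_of_nonAnomalous W p (by omega) hgood hna)
      (not_dvd_tamagawaProduct_of_kodairaNeron W p h5 hKN) ℓ₁ ℓ₂ n hne hnl hn P₁ P₂ h01 h10 h1t hδ
  · rintro ⟨hrank, hsha⟩ D hc hu
    have hirr : W.HasIrreducibleModPGaloisRep p := hasIrreducibleModPGaloisRep_of_hasSurjectiveModNGaloisRep W p hsur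
    have hle : Nat.card (W.selmerGroup p) ≤ p ^ 2 := by
      rw [natCard_selmerGroup_eq_pow_rank_of_sha_inf_torsionBy_eq_bot W p hirr hsha, hrank]
    exact kuriharaClaim_pair_of_natCard_selmerGroup_le_sq hSakR W p h5 hgood hord hsur hna hKN hle ℓ₁ ℓ₂ n hne hnl
      hn P₁ P₂ h01 h10 h1t D hc hu

end Summit.BirchSwinnertonDyer.BirchSwinnertonDyer.Theorems.KolyvaginDepthDoor

end
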